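import Mathlib
import Literature.Probability.LatticeModels.ThermodynamicLimit
import Literature.Probability.LatticeModels.SharpnessProofs
import Summits.CriticalPhenomena.Ising3DConformalLimit.Theorems.PrecisionLaplacianDirectCorrelationStableTailKernelScalingAux
import HarnessLib

/-!
# Helpers (I) for stub `stub_rieszGaussian` of line `diffusive-branch-is-nonsaturation`
(crux `PrecisionLaplacian.DirectCorrelationStableTail`, item stmt-CriticalPhenomena-4799)

**Subordination and the Gaussian integral.**  For `1 < α < 2`, `t > 0`, `k, u ∈ ℝ³ = Fin 3 → ℝ`
and `φ(w) = e^{-t|w|₂²} cos(k·w)`, the Gaussian-regularised Riesz–Fourier integral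
`D(u) = ∫ |v|₂^{α-3} (φ(v) − φ(v+u)) dv` is rewritten as a one-dimensional integral
(registered helper sub-goal `stub_rieszGaussian_auxRepresentation`):

  `D(u) = π^{3/2} Γ(β)⁻¹ ∫_{s>0} s^{β-1} (s+t)^{-3/2} e^{-|k|₂²/(4(s+t))}`
  `         · (1 − e^{-(st/(s+t))|u|₂²} cos((s/(s+t)) k·u)) ds`,   `β = (3 − α)/2`.

Ingredients:
* Euler's integral `|v|₂^{α-3} = Γ(β)⁻¹ ∫_0^∞ s^{β-1} e^{-s|v|₂²} ds` (`v ≠ 0`; Mathlib's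
  `Real.integral_rpow_mul_exp_neg_mul_Ioi`) and Fubini on `ℝ³ × (0,∞)`: integrating `s` first
  returns `Γ(β)|v|₂^{α-3}|Φ(v)|`, which is integrable (`kernSc_integrable_kernel_mul` of the landed
  `…KernelScalingAux` file), so the signed double integrand is absolutely integrable
  (`rieszG_subordination`; this mirrors `Literature.Analysis.SpecialFunctions.
  integral_mul_abs_rpow_neg_eq_integral_gaussian`, the one-dimensional nonnegative version);
* the Gaussian integral with a linear phase on `Fin 3 → ℝ` (product Lebesgue measure), from
  Mathlib's `GaussianFourier.integral_cexp_neg_mul_sum_add` by completing the square and taking real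
  parts (`rieszG_gauss_integral`):
  `∫ e^{-s|v|²} e^{-t|v+u|²} cos(k·(v+u)) dv
     = (π/(s+t))^{3/2} e^{-|k|²/(4(s+t))} e^{-(st/(s+t))|u|²} cos((s/(s+t)) k·u)`.

All statements are folklore (Fourier transform of the Riesz kernel via Gaussian subordination:
E. M. Stein, *Singular Integrals and Differentiability Properties of Functions* (1970), Ch. V §1,
Lemma 1); no definitions are introduced.
-/

noncomputable section

namespace Summit.CriticalPhenomena.Ising3DConformalLimit.Cruxes.DirectCorrelationStableTail.DiffusiveBranchIsNonsaturation

open MeasureTheory Filter Topology Set Complex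
open scoped BigOperators
open Literature.Probability.LatticeModels

/-! ### The Gaussian integral with a linear phase on `ℝ³` -/

/-- **Gaussian integral with phase.**  For `s, t > 0` and `k, u ∈ ℝ³`,
`∫ e^{-s|v|²} e^{-t|v+u|²} cos(k·(v+u)) dv
  = (π/(s+t))^{3/2} e^{-|k|²/(4(s+t))} · e^{-(st/(s+t))|u|²} cos((s/(s+t)) k·u)`
(complete the square; real part of Mathlib's complex Gaussian integral
`GaussianFourier.integral_cexp_neg_mul_sum_add` with `b = s + t`, `cᵢ = -2tuᵢ + i kᵢ`). [folklore] -/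
theorem rieszG_gauss_integral {s t : ℝ} (hs : 0 < s) (ht : 0 < t) (k u : Fin 3 → ℝ) :
    ∫ v : Fin 3 → ℝ, Real.exp (-(s * ∑ i, v i ^ 2)) *
        (Real.exp (-(t * ∑ i, (v i + u i) ^ 2)) * Real.cos (∑ i, k i * (v i + u i))) =
      (Real.pi / (s + t)) ^ (3 / 2 : ℝ) * Real.exp (-(∑ i, k i ^ 2) / (4 * (s + t))) *
        (Real.exp (-(s * t / (s + t) * ∑ i, u i ^ 2)) *
          Real.cos (s / (s + t) * ∑ i, k i * u i)) := by
  have hst : 0 < s + t := add_pos hs ht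
  -- the complex Gaussian data
  set b : ℂ := ((s + t : ℝ) : ℂ) with hb
  have hbre : 0 < b.re := by simp [hb, hst]
  set c : Fin 3 → ℂ := fun i => ((-2 * t * u i : ℝ) : ℂ) + ((k i : ℝ) : ℂ) * I with hc
  set C : ℂ := cexp (((-(t * ∑ i, u i ^ 2) : ℝ) : ℂ) + ((∑ i, k i * u i : ℝ) : ℂ) * I) with hC
  -- pointwise: the real integrand is the real part of `C * cexp (-b Σ vᵢ² + Σ cᵢ vᵢ)`
  have hpt : ∀ v : Fin 3 → ℝ, Real.exp (-(s * ∑ i, v i ^ 2)) *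
      (Real.exp (-(t * ∑ i, (v i + u i) ^ 2)) * Real.cos (∑ i, k i * (v i + u i))) =
      RCLike.re (C * cexp (-b * ∑ i, ((v i : ℝ) : ℂ) ^ 2 + ∑ i, c i * (v i : ℝ))) := by
    intro v
    have hexp : C * cexp (-b * ∑ i, ((v i : ℝ) : ℂ) ^ 2 + ∑ i, c i * (v i : ℝ)) =
        cexp (((-(s * ∑ i, v i ^ 2) + -(t * ∑ i, (v i + u i) ^ 2) : ℝ) : ℂ) +
          ((∑ i, k i * (v i + u i) : ℝ) : ℂ) * I) := by
      rw [hC, ← Complex.exp_add]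
      congr 1
      simp only [hb, hc, Fin.sum_univ_three]
      push_cast
      ring
    rw [hexp, RCLike.re_to_complex, Complex.exp_re, Complex.add_re, Complex.ofReal_re,
      Complex.add_im, Complex.ofReal_im, Complex.mul_I_re, Complex.mul_I_im, Complex.ofReal_im,
      Complex.ofReal_re, neg_zero, add_zero, zero_add, Real.exp_add]
    ring
  have hint : Integrable (fun v : Fin 3 → ℝ =>
      C * cexp (-b * ∑ i, ((v i : ℝ) : ℂ) ^ 2 + ∑ i, c i * (v i : ℝ))) :=
    (GaussianFourier.integrable_cexp_neg_mul_sum_add hbre c).const_mul C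
  simp_rw [hpt]
  rw [integral_re hint, integral_const_mul, GaussianFourier.integral_cexp_neg_mul_sum_add hbre c]
  -- evaluate the closed form
  have hcard : ((Fintype.card (Fin 3) : ℂ) / 2) = ((3 / 2 : ℝ) : ℂ) := by
    push_cast
    simp
  have hpow : (↑Real.pi / b) ^ ((Fintype.card (Fin 3) : ℂ) / 2) =
      (((Real.pi / (s + t)) ^ (3 / 2 : ℝ) : ℝ) : ℂ) := by
    rw [hcard, Complex.ofReal_cpow (by positivity : 0 ≤ Real.pi / (s + t))]
    congr 1
    simp [hb]
  have hexp2 : C * cexp ((∑ i, c i ^ 2) / (4 * b)) =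
      cexp (((-(∑ i, k i ^ 2) / (4 * (s + t)) + -(s * t / (s + t) * ∑ i, u i ^ 2) : ℝ) : ℂ) +
        ((s / (s + t) * ∑ i, k i * u i : ℝ) : ℂ) * I) := by
    rw [hC, ← Complex.exp_add]
    congr 1
    have hst' : (s : ℂ) + (t : ℂ) ≠ 0 := by
      rw [← Complex.ofReal_add]
      exact_mod_cast hst.ne'
    simp only [hb, hc, Fin.sum_univ_three]
    push_cast
    field_simp
    ring_nf
    simp only [Complex.I_sq]
    ring
  rw [hpow, mul_left_comm, hexp2, RCLike.re_to_complex, Complex.re_ofReal_mul, Complex.exp_re,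
    Complex.add_re, Complex.ofReal_re, Complex.add_im, Complex.ofReal_im, Complex.mul_I_re,
    Complex.mul_I_im, Complex.ofReal_im, Complex.ofReal_re, neg_zero, add_zero, zero_add,
    Real.exp_add]
  ring

/-- The unshifted case `u = 0` of `rieszG_gauss_integral`:
`∫ e^{-s|v|²} e^{-t|v|²} cos(k·v) dv = (π/(s+t))^{3/2} e^{-|k|²/(4(s+t))}`. [folklore] -/
theorem rieszG_gauss_integral_zero {s t : ℝ} (hs : 0 < s) (ht : 0 < t) (k : Fin 3 → ℝ) :
    ∫ v : Fin 3 → ℝ, Real.exp (-(s * ∑ i, v i ^ 2)) *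
        (Real.exp (-(t * ∑ i, v i ^ 2)) * Real.cos (∑ i, k i * v i)) =
      (Real.pi / (s + t)) ^ (3 / 2 : ℝ) * Real.exp (-(∑ i, k i ^ 2) / (4 * (s + t))) := by
  simpa using rieszG_gauss_integral hs ht k 0

/-- Gaussian integrability on `ℝ³`, unshifted form (from `kernSc_integrable_gauss`). [folklore] -/
theorem rieszG_integrable_gauss {b : ℝ} (hb : 0 < b) :
    Integrable (fun v : Fin 3 → ℝ => Real.exp (-(b * ∑ i, v i ^ 2))) := by
  simpa using kernSc_integrable_gauss hb 0

/-- Integrability of `e^{-s|v|²} · (e^{-t|v+u|²} cos(k·(v+u)))` on `ℝ³` for `s > 0`, `t ≥ 0`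
(a Gaussian times a factor bounded by `1`). [folklore] -/
theorem rieszG_integrable_gauss_phi {s : ℝ} (hs : 0 < s) {t : ℝ} (ht : 0 ≤ t)
    (k u : Fin 3 → ℝ) :
    Integrable (fun v : Fin 3 → ℝ => Real.exp (-(s * ∑ i, v i ^ 2)) *
      (Real.exp (-(t * ∑ i, (v i + u i) ^ 2)) * Real.cos (∑ i, k i * (v i + u i)))) := by
  refine (rieszG_integrable_gauss hs).mul_bdd (c := 1) ?_ (ae_of_all _ fun v => ?_)
  · exact (by fun_prop : Continuous fun v : Fin 3 → ℝ =>
      Real.exp (-(t * ∑ i, (v i + u i) ^ 2)) *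
        Real.cos (∑ i, k i * (v i + u i))).aestronglyMeasurable
  · rw [norm_mul, Real.norm_eq_abs, Real.norm_eq_abs, Real.abs_exp]
    have h1 : Real.exp (-(t * ∑ i, (v i + u i) ^ 2)) ≤ 1 := by
      rw [Real.exp_le_one_iff, neg_nonpos]
      exact mul_nonneg ht (Finset.sum_nonneg fun i _ => sq_nonneg _)
    have h2 : |Real.cos (∑ i, k i * (v i + u i))| ≤ 1 := Real.abs_cos_le_one _
    calc Real.exp (-(t * ∑ i, (v i + u i) ^ 2)) * |Real.cos (∑ i, k i * (v i + u i))|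
        ≤ 1 * 1 := mul_le_mul h1 h2 (abs_nonneg _) zero_le_one
      _ = 1 := one_mul 1

/-- Integrability of the Riesz kernel `|v|₂^{α-3}` (`0 < α < 3`) against
`e^{-t|v+u|²} cos(k·(v+u))` for `t > 0` (from `kernSc_integrable_kernel_mul`). [folklore] -/
theorem rieszG_integrable_kernel_phi {α : ℝ} (hα0 : 0 < α) (hα3 : α < 3) {t : ℝ} (ht : 0 < t)
    (k u : Fin 3 → ℝ) :
    Integrable (fun v : Fin 3 → ℝ => √(∑ i, v i ^ 2) ^ (α - 3) *
      (Real.exp (-(t * ∑ i, (v i + u i) ^ 2)) * Real.cos (∑ i, k i * (v i + u i)))) := by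
  refine kernSc_integrable_kernel_mul hα0 hα3 ?_ ht zero_le_one u fun v => ?_
  · exact (by fun_prop : Continuous fun v : Fin 3 → ℝ =>
      Real.exp (-(t * ∑ i, (v i + u i) ^ 2)) *
        Real.cos (∑ i, k i * (v i + u i))).aestronglyMeasurable
  · rw [abs_mul, Real.abs_exp, one_mul]
    exact mul_le_of_le_one_right (Real.exp_pos _).le (Real.abs_cos_le_one _)

/-! ### Euler's integral and the subordination identity -/

/-- **Euler's integral** in the form `∫_0^∞ s^{β-1} e^{-s r} ds = Γ(β) (√r)^{α-3}` for `r > 0`,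
`β = (3-α)/2 > 0` (Mathlib's `Real.integral_rpow_mul_exp_neg_mul_Ioi`). [folklore] -/
theorem rieszG_euler {α : ℝ} (hα3 : α < 3) {r : ℝ} (hr : 0 < r) :
    ∫ s in Ioi (0 : ℝ), s ^ ((3 - α) / 2 - 1) * Real.exp (-(s * r)) =
      Real.Gamma ((3 - α) / 2) * √r ^ (α - 3) := by
  have hβ : 0 < (3 - α) / 2 := by linarith
  have h1 : ∀ s : ℝ, Real.exp (-(s * r)) = Real.exp (-(r * s)) := fun s => by rw [mul_comm]
  simp_rw [h1]
  rw [Real.integral_rpow_mul_exp_neg_mul_Ioi hβ hr, mul_comm]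
  congr 1
  rw [Real.sqrt_eq_rpow, ← Real.rpow_mul hr.le, one_div, Real.inv_rpow hr.le,
    ← Real.rpow_neg hr.le]
  congr 1
  ring

/-- The Euler integrand `s^{β-1} e^{-s r}` is integrable on `(0, ∞)` for `r > 0`, `β = (3-α)/2 > 0`
(its integral is the positive number `Γ(β)(√r)^{α-3}`, so it is not the junk value `0`).
[folklore] -/
theorem rieszG_euler_integrableOn {α : ℝ} (hα3 : α < 3) {r : ℝ} (hr : 0 < r) :
    IntegrableOn (fun s : ℝ => s ^ ((3 - α) / 2 - 1) * Real.exp (-(s * r))) (Ioi 0) := by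
  have heq := rieszG_euler hα3 hr
  by_contra hni
  rw [integral_undef hni] at heq
  have : 0 < Real.Gamma ((3 - α) / 2) * √r ^ (α - 3) :=
    mul_pos (Real.Gamma_pos_of_pos (by linarith)) (Real.rpow_pos_of_pos (Real.sqrt_pos.2 hr) _)
  linarith

/-- **Subordination (Gaussian-mixture) representation of the Riesz kernel on `ℝ³`, with Fubini.**
For `α < 3`, `β = (3-α)/2`, and a measurable `Φ : ℝ³ → ℝ` with `|v|₂^{α-3} Φ(v)` integrable, the
function `(v, s) ↦ Φ(v) s^{β-1} e^{-s|v|₂²}` is integrable on `ℝ³ × (0,∞)` and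
`∫ |v|₂^{α-3} Φ(v) dv = Γ(β)⁻¹ ∫_0^∞ s^{β-1} (∫ e^{-s|v|₂²} Φ(v) dv) ds`
(integrate `s` first: Euler's integral returns `Γ(β)|v|₂^{α-3}|Φ(v)|`, integrable by hypothesis).
[folklore] -/
theorem rieszG_subordination {α : ℝ} (hα3 : α < 3) {Φ : (Fin 3 → ℝ) → ℝ}
    (hΦm : Measurable Φ)
    (hint : Integrable (fun v : Fin 3 → ℝ => √(∑ i, v i ^ 2) ^ (α - 3) * Φ v)) :
    Integrable (fun q : (Fin 3 → ℝ) × ℝ =>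
        Φ q.1 * (q.2 ^ ((3 - α) / 2 - 1) * Real.exp (-(q.2 * ∑ i, q.1 i ^ 2))))
        ((volume : Measure (Fin 3 → ℝ)).prod (volume.restrict (Ioi 0))) ∧
    ∫ v, √(∑ i, v i ^ 2) ^ (α - 3) * Φ v = (Real.Gamma ((3 - α) / 2))⁻¹ *
      ∫ s in Ioi (0 : ℝ), s ^ ((3 - α) / 2 - 1) *
        ∫ v : Fin 3 → ℝ, Real.exp (-(s * ∑ i, v i ^ 2)) * Φ v := by
  set β : ℝ := (3 - α) / 2 with hβdef
  set F : (Fin 3 → ℝ) × ℝ → ℝ := fun q =>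
    Φ q.1 * (q.2 ^ (β - 1) * Real.exp (-(q.2 * ∑ i, q.1 i ^ 2))) with hF
  have hFm : Measurable F := by
    simp only [hF]
    fun_prop
  have hΓ : 0 < Real.Gamma β := Real.Gamma_pos_of_pos (by rw [hβdef]; linarith)
  -- a nonzero vector has positive squared norm
  have hpos : ∀ v : Fin 3 → ℝ, v ≠ 0 → 0 < ∑ i, v i ^ 2 := fun v hv => by
    rcases Function.ne_iff.1 hv with ⟨i, hi⟩
    calc (0 : ℝ) < v i ^ 2 := by
          have : v i ≠ 0 := hi
          positivity
      _ ≤ ∑ j, v j ^ 2 := Finset.single_le_sum (fun j _ => sq_nonneg (v j)) (Finset.mem_univ i)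
  have hGam : ∀ v : Fin 3 → ℝ, v ≠ 0 →
      IntegrableOn (fun s : ℝ => s ^ (β - 1) * Real.exp (-(s * ∑ i, v i ^ 2))) (Ioi 0) ∧
      ∫ s in Ioi (0 : ℝ), s ^ (β - 1) * Real.exp (-(s * ∑ i, v i ^ 2)) =
        Real.Gamma β * √(∑ i, v i ^ 2) ^ (α - 3) := fun v hv =>
    ⟨rieszG_euler_integrableOn hα3 (hpos v hv), rieszG_euler hα3 (hpos v hv)⟩
  have hae : ∀ᵐ v : Fin 3 → ℝ, v ≠ 0 := by
    have : ({(0 : Fin 3 → ℝ)}ᶜ : Set (Fin 3 → ℝ)) ∈ ae (volume : Measure (Fin 3 → ℝ)) :=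
      compl_mem_ae_iff.mpr (measure_singleton 0)
    filter_upwards [this] with v hv
    exact hv
  have hFnorm : ∀ v : Fin 3 → ℝ, ∀ s ∈ Ioi (0 : ℝ),
      ‖F (v, s)‖ = |Φ v| * (s ^ (β - 1) * Real.exp (-(s * ∑ i, v i ^ 2))) := by
    intro v s hs
    rw [Real.norm_eq_abs, hF, abs_mul]
    congr 1
    exact abs_of_nonneg (mul_nonneg (Real.rpow_nonneg (le_of_lt hs) _) (Real.exp_pos _).le)
  have hprod : Integrable F ((volume : Measure (Fin 3 → ℝ)).prod (volume.restrict (Ioi 0))) := by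
    rw [integrable_prod_iff hFm.aestronglyMeasurable]
    constructor
    · filter_upwards [hae] with v hv
      exact (hGam v hv).1.const_mul (Φ v)
    · have heq : (fun v => ∫ s in Ioi (0 : ℝ), ‖F (v, s)‖) =ᵐ[volume]
          fun v => Real.Gamma β * ‖√(∑ i, v i ^ 2) ^ (α - 3) * Φ v‖ := by
        filter_upwards [hae] with v hv
        rw [setIntegral_congr_fun measurableSet_Ioi (hFnorm v), integral_const_mul, (hGam v hv).2,
          Real.norm_eq_abs, abs_mul, abs_of_nonneg (Real.rpow_nonneg (Real.sqrt_nonneg _) _)]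
        ring
      rw [integrable_congr heq]
      exact hint.norm.const_mul _
  refine ⟨hprod, ?_⟩
  calc ∫ v, √(∑ i, v i ^ 2) ^ (α - 3) * Φ v
      = ∫ v, (Real.Gamma β)⁻¹ * ∫ s in Ioi (0 : ℝ), F (v, s) := by
        refine integral_congr_ae ?_
        filter_upwards [hae] with v hv
        simp only [hF]
        rw [integral_const_mul, (hGam v hv).2]
        field_simp
    _ = (Real.Gamma β)⁻¹ * ∫ v, ∫ s in Ioi (0 : ℝ), F (v, s) := integral_const_mul _ _
    _ = (Real.Gamma β)⁻¹ * ∫ s in Ioi (0 : ℝ), ∫ v, F (v, s) := by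
        rw [integral_integral_swap (f := fun v s => F (v, s)) hprod]
    _ = (Real.Gamma β)⁻¹ *
          ∫ s in Ioi (0 : ℝ), s ^ (β - 1) * ∫ v, Real.exp (-(s * ∑ i, v i ^ 2)) * Φ v := by
        congr 1
        refine setIntegral_congr_fun measurableSet_Ioi fun s _ => ?_
        simp only [hF]
        rw [← integral_const_mul]
        congr 1
        funext v
        ring

/-! ### The one-dimensional representation of `D(u)` -/

/-- **Registered helper sub-goal `stub_rieszGaussian_auxRepresentation`** of stub
`stub_rieszGaussian` (line `diffusive-branch-is-nonsaturation`, crux stmt-CriticalPhenomena-4799):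
for `1 < α < 2`, `t > 0`, `k, u ∈ ℝ³`, with `β = (3-α)/2`,
`∫ |v|₂^{α-3} (e^{-t|v|²}cos(k·v) − e^{-t|v+u|²}cos(k·(v+u))) dv
   = π^{3/2} Γ(β)⁻¹ ∫_0^∞ s^{β-1}(s+t)^{-3/2} e^{-|k|²/(4(s+t))} (1 − e^{-(st/(s+t))|u|²} cos((s/(s+t)) k·u)) ds`
(subordination `rieszG_subordination` + the Gaussian integral `rieszG_gauss_integral`). [folklore] -/
theorem stub_rieszGaussian_auxRepresentation :
    ∀ (α : ℝ), 1 < α → α < 2 → ∀ (k u : Fin 3 → ℝ) (t : ℝ), 0 < t →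
      ∫ v : Fin 3 → ℝ, Real.sqrt (∑ i, v i ^ 2) ^ (α - 3) *
          (Real.exp (-(t * ∑ i, v i ^ 2)) * Real.cos (∑ i, k i * v i) -
            Real.exp (-(t * ∑ i, (v i + u i) ^ 2)) * Real.cos (∑ i, k i * (v i + u i))) =
      Real.pi ^ (3 / 2 : ℝ) / Real.Gamma ((3 - α) / 2) *
        ∫ s in Set.Ioi (0 : ℝ), s ^ ((3 - α) / 2 - 1) * (s + t) ^ (-(3 / 2 : ℝ)) *
          Real.exp (-(∑ i, k i ^ 2) / (4 * (s + t))) *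
          (1 - Real.exp (-(s * t / (s + t) * ∑ i, u i ^ 2)) *
            Real.cos (s / (s + t) * ∑ i, k i * u i)) := by
  intro α hα1 hα2 k u t ht
  have hα0 : 0 < α := by linarith
  have hα3 : α < 3 := by linarith
  -- integrability of the two pieces against the kernel
  have h1 := rieszG_integrable_kernel_phi hα0 hα3 ht k 0
  have h2 := rieszG_integrable_kernel_phi hα0 hα3 ht k u
  simp only [Pi.zero_apply, add_zero] at h1
  have hint : Integrable (fun v : Fin 3 → ℝ => √(∑ i, v i ^ 2) ^ (α - 3) *
      (Real.exp (-(t * ∑ i, v i ^ 2)) * Real.cos (∑ i, k i * v i) -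
        Real.exp (-(t * ∑ i, (v i + u i) ^ 2)) * Real.cos (∑ i, k i * (v i + u i)))) := by
    refine (h1.sub h2).congr (ae_of_all _ fun v => ?_)
    simp only [Pi.sub_apply]
    ring
  have hΦm : Measurable (fun v : Fin 3 → ℝ =>
      Real.exp (-(t * ∑ i, v i ^ 2)) * Real.cos (∑ i, k i * v i) -
        Real.exp (-(t * ∑ i, (v i + u i) ^ 2)) * Real.cos (∑ i, k i * (v i + u i))) := by
    fun_prop
  rw [(rieszG_subordination hα3 hΦm hint).2]
  -- evaluate the inner Gaussian integrals
  have hinner : ∀ s ∈ Ioi (0 : ℝ),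
      s ^ ((3 - α) / 2 - 1) * ∫ v : Fin 3 → ℝ, Real.exp (-(s * ∑ i, v i ^ 2)) *
        (Real.exp (-(t * ∑ i, v i ^ 2)) * Real.cos (∑ i, k i * v i) -
          Real.exp (-(t * ∑ i, (v i + u i) ^ 2)) * Real.cos (∑ i, k i * (v i + u i))) =
      Real.pi ^ (3 / 2 : ℝ) * (s ^ ((3 - α) / 2 - 1) * (s + t) ^ (-(3 / 2 : ℝ)) *
          Real.exp (-(∑ i, k i ^ 2) / (4 * (s + t))) *
          (1 - Real.exp (-(s * t / (s + t) * ∑ i, u i ^ 2)) *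
            Real.cos (s / (s + t) * ∑ i, k i * u i))) := by
    intro s hs
    have hs' : 0 < s := hs
    have hst : 0 < s + t := add_pos hs' ht
    have i1 := rieszG_integrable_gauss_phi hs' ht.le k 0
    have i2 := rieszG_integrable_gauss_phi hs' ht.le k u
    simp only [Pi.zero_apply, add_zero] at i1
    have hsplit : ∫ v : Fin 3 → ℝ, Real.exp (-(s * ∑ i, v i ^ 2)) *
        (Real.exp (-(t * ∑ i, v i ^ 2)) * Real.cos (∑ i, k i * v i) -
          Real.exp (-(t * ∑ i, (v i + u i) ^ 2)) * Real.cos (∑ i, k i * (v i + u i))) =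
        (∫ v : Fin 3 → ℝ, Real.exp (-(s * ∑ i, v i ^ 2)) *
          (Real.exp (-(t * ∑ i, v i ^ 2)) * Real.cos (∑ i, k i * v i))) -
        ∫ v : Fin 3 → ℝ, Real.exp (-(s * ∑ i, v i ^ 2)) *
          (Real.exp (-(t * ∑ i, (v i + u i) ^ 2)) * Real.cos (∑ i, k i * (v i + u i))) := by
      rw [← integral_sub i1 i2]
      congr 1
      funext v
      ring
    rw [hsplit, rieszG_gauss_integral_zero hs' ht k, rieszG_gauss_integral hs' ht k u,
      Real.div_rpow Real.pi_pos.le hst.le, Real.rpow_neg hst.le]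
    field_simp
  rw [setIntegral_congr_fun measurableSet_Ioi hinner, integral_const_mul]
  ring

end Summit.CriticalPhenomena.Ising3DConformalLimit.Cruxes.DirectCorrelationStableTail.DiffusiveBranchIsNonsaturation

end
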